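import Literature.Analysis.OperatorTheory.NcPolynomialLift
import Mathlib.Algebra.MvPolynomial.Monad
import Literature.Analysis.OperatorTheory.StablePolynomialInverseSeries
import Literature.Analysis.OperatorTheory.ContractiveDeterminantalRepresentations

/-!
# Proof of `gkvvw_contractive_repr` (GKVVW, Math. Z. 2016, Thm. 3.1, polydisc case)

`gkvvw_contractive_repr_holds` discharges the named fact of
`ContractiveDeterminantalRepresentations.lean`: an irreducible (this hypothesis is not used)
polynomial `p ∈ ℂ[z_σ]` with `p(0) = 1` and no zero on the closed unit polydisc is
`det(1 + diag(z_{κ(i)}) K)` with `‖K‖ < 1`.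

## The argument

The published proof (arXiv v1 of [GrinshpanEtAl2015], §3) lifts `p` to an nc polynomial through a
determinantal representation, proves a matrix-valued Hermitian Positivstellensatz certificate, runs
the lurking-contraction argument to get a contractive realization of an nc rational function whose
commutative restriction is `p`, and removes the spurious factor by a minimality/shift argument
(Cor. 2.2 applied at matrix level `1`). That last step does not survive formalization (a structured
realization of an nc rational function with constant level-`1` restriction can have
`det(I - A Z(z))` vanishing on the polydisc), so the factor is killed differently here, entirely at
the level of WORDS:
1. `exists_radius_gt_one_of_noZero` (`StablePolynomialInverseSeries.lean`): stability margin
   `r > 1`; work with the dilate `P(z) = p(ρz)`, `1 < ρ < r`, zero-free on the polydisc of radius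
   `r/ρ > 1`, and undo the dilation at the end (this makes the contraction strict).
2. `exists_ncLift` (this file, from `NcPolynomialLift`): `P = ab P̂` for an
   nc polynomial `P̂ = trunc_N exp Ĥ_N` (`Ĥ_N` the lifted truncated Euler logarithm of `P`), which is
   invertible with bounded inverse at all operator tuples `‖Y_j‖ ≤ ρ₁` (`ρ₁ > 1`; Cauchy estimates
   for the coefficients of `log P` from `norm_coeff_inv_le`), whence nc polynomials `Q, E` with
   `Q P̂ + E = 1`, `‖Q(X)‖ ≤ C`, `‖E(X)‖ ≤ ε` on contractions (circle estimate).
3. `hsqN_sub_smul_unitK_mem_coneN` (`FreePolydiscPositivstellensatz.lean`): the free hereditary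
   certificate `P̂*P̂ - c² ∈ 𝒞_free`.
4. `ab_eq_det_of_certificate` (`FreeDeterminantalRealization.lean`): lurking contraction and a
   nilpotent structured realization give `P = det(I - A Z)`, `‖A‖ ≤ 1`, exactly.
5. Undo the dilation (`bind₁ (z ↦ z/ρ)`), Sylvester's identity and reindexing by `Fin R`
   (`det_pencil_reindex`, `norm_toEuclideanCLM_reindex_le` from the fact file).

## References

* [GrinshpanEtAl2015] A. Grinshpan, D. S. Kaliuzhnyi-Verbovetskyi, V. Vinnikov, H. J. Woerdeman,
  Contractive determinantal representations of stable polynomials on a matrix polyball, Math. Z. 283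
  (2016) 25–37 = arXiv:1503.06161, Thm. 3.1 (p. 8) and its proof.
* [GrinshpanEtAl2016] the same, Matrix-valued Hermitian Positivstellensatz, lurking contractions, and
  contractive determinantal representations of stable polynomials, Oper. Theory Adv. Appl. 255 (2016)
  123–136, Thm. 2.3 (Positivstellensatz), Thm. 3.4 (lurking contraction).
* [HeltonMccullough2004] J. W. Helton, S. McCullough, A Positivstellensatz for non-commutative
  polynomials, Trans. Amer. Math. Soc. 356 (2004) 3721–3737 (the free Positivstellensatz technique).
-/

noncomputable section

namespace Literature.Analysis.OperatorTheory
namespace GKVVW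

open Finset
open scoped Nat

variable {σ : Type}

/-! ### Invertibility of the lift on a larger nc polydisc -/

section StageC

open MvPolynomial

variable [Fintype σ] [DecidableEq σ]

omit [Fintype σ] [DecidableEq σ] in
/-- The partial sums `Σ_{α ∈ S} ‖q_α‖ ρ^{|α|}` are monotone in `ρ ≥ 0`. [folklore] -/
theorem sum_norm_coeff_mono {q : MvPowerSeries σ ℂ} {ρ ρ' : ℝ} (hρ : 0 ≤ ρ) (h : ρ ≤ ρ')
    (S : Finset (σ →₀ ℕ)) :
    ∑ α ∈ S, ‖MvPowerSeries.coeff α q‖ * ρ ^ α.degree ≤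
      ∑ α ∈ S, ‖MvPowerSeries.coeff α q‖ * ρ' ^ α.degree :=
  Finset.sum_le_sum fun _ _ =>
    mul_le_mul_of_nonneg_left (pow_le_pow_left₀ hρ h _) (norm_nonneg _)

omit [DecidableEq σ] in
/-- `|Ĥ_N|_ρ ≤ B` when `B` bounds the partial sums `Σ ‖h_α‖ ρ^{|α|}` of the Euler logarithm `h` of `P`. [folklore] -/
theorem wnorm_hLift_le (P : MvPolynomial σ ℂ) {ρ B : ℝ} (hρ : 0 ≤ ρ)
    (hB : ∀ S : Finset (σ →₀ ℕ), ∑ α ∈ S,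
      ‖MvPowerSeries.coeff α (eulerLog (P : MvPowerSeries σ ℂ))‖ * ρ ^ α.degree ≤ B) (N : ℕ) :
    wnorm ρ (hLift N P) ≤ B :=
  (wnorm_ncLift_le hρ _ _).trans (hB _)

omit [DecidableEq σ] in
/-- `|Σ_{k ≤ N} Ĥ_N^k / k!|_ρ ≤ e^B` under the same bound `B`. [folklore] -/
theorem wnorm_expLift_le (P : MvPolynomial σ ℂ) {ρ B : ℝ} (hρ : 0 ≤ ρ)
    (hB : ∀ S : Finset (σ →₀ ℕ), ∑ α ∈ S,
      ‖MvPowerSeries.coeff α (eulerLog (P : MvPowerSeries σ ℂ))‖ * ρ ^ α.degree ≤ B) (N : ℕ) :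
    wnorm ρ (expLift N P) ≤ Real.exp B := by
  have hB0 : 0 ≤ B := le_trans (by rw [Finset.sum_empty]) (hB ∅)
  have hH := wnorm_hLift_le P hρ hB N
  rw [expLift]
  refine (wnorm_sum_le hρ _ _).trans (le_trans (Finset.sum_le_sum fun k _ => ?_)
    (Real.sum_le_exp_of_nonneg hB0 (N + 1)))
  rw [wnorm_smul, norm_inv, Complex.norm_natCast, div_eq_inv_mul]
  refine mul_le_mul_of_nonneg_left ((wnorm_pow_le hρ _ k).trans ?_) (inv_nonneg.mpr (by positivity))
  exact pow_le_pow_left₀ (wnorm_nonneg hρ _) hH k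

omit [Fintype σ] [DecidableEq σ] in
/-- Evaluation commutes with the truncated exponential sum: `(Σ_{k ≤ N} F^k/k!)(Y) = Σ_{k ≤ N} F(Y)^k/k!`. [folklore] -/
theorem ncEval_sum_smul_pow {𝔄 : Type*} [Ring 𝔄] [Algebra ℂ 𝔄] (Y : σ → 𝔄) (N : ℕ) (F : NC σ) :
    ncEval Y (∑ k ∈ range (N + 1), ((k ! : ℂ)⁻¹) • F ^ k) =
      ∑ k ∈ range (N + 1), ((k ! : ℂ)⁻¹) • ncEval Y F ^ k := by
  rw [map_sum]
  simp only [map_smul, map_pow]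

omit [DecidableEq σ] in
/-- **Invertibility of the lift.** For `‖Y_j‖ ≤ ρ₁` and `N` large, `P̂_N(Y)` is invertible with
`‖P̂_N(Y)⁻¹‖ ≤ 4 e^{B}`. [folklore] -/
theorem isUnit_ncEval_pLift {𝔄 : Type*} [NormedRing 𝔄] [NormedAlgebra ℂ 𝔄] [CompleteSpace 𝔄]
    (h1 : ‖(1 : 𝔄)‖ ≤ 1) (P : MvPolynomial σ ℂ) {ρ₁ ρ₂ B : ℝ} (hρ₁ : 0 < ρ₁) (h12 : ρ₁ ≤ ρ₂)
    (hB : ∀ S : Finset (σ →₀ ℕ), ∑ α ∈ S,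
      ‖MvPowerSeries.coeff α (eulerLog (P : MvPowerSeries σ ℂ))‖ * ρ₂ ^ α.degree ≤ B)
    {N : ℕ} (hN1 : Real.exp (4 * B) / 2 ^ (N + 1) ≤ 1 / 2)
    (hN2 : 2 * Real.exp B * ((ρ₁ / ρ₂) ^ (N + 1) * Real.exp B) ≤ 1 / 2)
    (Y : σ → 𝔄) (hY : ∀ j, ‖Y j‖ ≤ ρ₁) :
    IsUnit (ncEval Y (pLift N P)) ∧ ‖Ring.inverse (ncEval Y (pLift N P))‖ ≤ 4 * Real.exp B := by
  have hρ₂ : 0 < ρ₂ := lt_of_lt_of_le hρ₁ h12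
  have hB₁ : ∀ S : Finset (σ →₀ ℕ), ∑ α ∈ S,
      ‖MvPowerSeries.coeff α (eulerLog (P : MvPowerSeries σ ℂ))‖ * ρ₁ ^ α.degree ≤ B :=
    fun S => (sum_norm_coeff_mono hρ₁.le h12 S).trans (hB S)
  set x := ncEval Y (hLift N P) with hx
  have hxB : ‖x‖ ≤ B :=
    (norm_ncEval_le Y hρ₁.le hY h1 _).trans (wnorm_hLift_le P hρ₁.le hB₁ N)
  have ha : ncEval Y (expLift N P) = texp N x := by rw [expLift, ncEval_sum_smul_pow, texp]
  obtain ⟨hu, hun⟩ := isUnit_texp h1 N hxB hN1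
  have hdiff : ‖texp N x - ncEval Y (pLift N P)‖ ≤ (ρ₁ / ρ₂) ^ (N + 1) * Real.exp B := by
    rw [← ha, ← map_sub, pLift]
    refine (norm_ncEval_le Y hρ₁.le hY h1 _).trans ?_
    refine (wnorm_sub_truncW_le hρ₁.le h12 hρ₂ N _).trans ?_
    exact mul_le_mul_of_nonneg_left (wnorm_expLift_le P hρ₂.le hB N) (by positivity)
  refine isUnit_of_norm_sub_le h1 hu hun ?_ |>.imp id fun h => by linarith
  exact le_trans (mul_le_mul_of_nonneg_left hdiff (by positivity)) hN2

omit [Fintype σ] [DecidableEq σ] in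
/-- Choice of the truncation order. [folklore] -/
theorem exists_liftOrder (P : MvPolynomial σ ℂ) {ρ₁ ρ₂ : ℝ} (B : ℝ) (hρ₁ : 0 < ρ₁) (h12 : ρ₁ < ρ₂) :
    ∃ N : ℕ, P.totalDegree ≤ N ∧ Real.exp (4 * B) / 2 ^ (N + 1) ≤ 1 / 2 ∧
      2 * Real.exp B * ((ρ₁ / ρ₂) ^ (N + 1) * Real.exp B) ≤ 1 / 2 := by
  have hρ₂ : 0 < ρ₂ := hρ₁.trans h12
  have hq0 : 0 ≤ ρ₁ / ρ₂ := div_nonneg hρ₁.le hρ₂.le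
  have hq1 : ρ₁ / ρ₂ < 1 := (div_lt_one hρ₂).mpr h12
  obtain ⟨n₁, hn₁⟩ := exists_pow_lt_of_lt_one
    (div_pos one_half_pos (Real.exp_pos (4 * B))) one_half_lt_one
  obtain ⟨n₂, hn₂⟩ := exists_pow_lt_of_lt_one
    (div_pos one_half_pos (mul_pos (mul_pos two_pos (Real.exp_pos B)) (Real.exp_pos B))) hq1
  refine ⟨max (max n₁ n₂) P.totalDegree, le_max_right _ _, ?_, ?_⟩
  · have hle : ((1 : ℝ) / 2) ^ (max (max n₁ n₂) P.totalDegree + 1) ≤ (1 / 2) ^ n₁ :=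
      pow_le_pow_of_le_one (by norm_num) (by norm_num) (by omega)
    rw [div_eq_mul_inv, ← inv_pow, show (2 : ℝ)⁻¹ = 1 / 2 by norm_num]
    calc Real.exp (4 * B) * (1 / 2) ^ (max (max n₁ n₂) P.totalDegree + 1)
        ≤ Real.exp (4 * B) * (1 / 2) ^ n₁ := mul_le_mul_of_nonneg_left hle (Real.exp_nonneg _)
      _ ≤ Real.exp (4 * B) * (1 / 2 / Real.exp (4 * B)) :=
          mul_le_mul_of_nonneg_left hn₁.le (Real.exp_nonneg _)
      _ = 1 / 2 := mul_div_cancel₀ _ (Real.exp_pos _).ne'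
  · have hle : (ρ₁ / ρ₂) ^ (max (max n₁ n₂) P.totalDegree + 1) ≤ (ρ₁ / ρ₂) ^ n₂ :=
      pow_le_pow_of_le_one hq0 hq1.le (by omega)
    have hpos : 0 < 2 * Real.exp B * Real.exp B := by positivity
    calc 2 * Real.exp B * ((ρ₁ / ρ₂) ^ (max (max n₁ n₂) P.totalDegree + 1) * Real.exp B)
        = (2 * Real.exp B * Real.exp B) * (ρ₁ / ρ₂) ^ (max (max n₁ n₂) P.totalDegree + 1) := by
          ring
      _ ≤ (2 * Real.exp B * Real.exp B) * (ρ₁ / ρ₂) ^ n₂ := mul_le_mul_of_nonneg_left hle hpos.le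
      _ ≤ (2 * Real.exp B * Real.exp B) * (1 / 2 / (2 * Real.exp B * Real.exp B)) :=
          mul_le_mul_of_nonneg_left hn₂.le hpos.le
      _ = 1 / 2 := mul_div_cancel₀ _ hpos.ne'

/-- **The nc lift with quantitative left inverses.** A polynomial `P` with `P(0) = 1` whose Euler
logarithm has `Σ_α ‖h_α‖ ρ₂^{|α|} ≤ B` (`1 < ρ₁ < ρ₂`) is the abelianisation of an nc polynomial `P̂`
with `P̂(∅) = 1` admitting, for every `ε > 0`, nc polynomials `Q, E` with `Q P̂ + E = 1`,
`‖Q(X)‖ ≤ C`, `‖E(X)‖ ≤ ε` at all tuples of Hilbert-space contractions. [folklore] -/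
theorem exists_ncLift (P : MvPolynomial σ ℂ) (hP : constantCoeff P = 1) {ρ₁ ρ₂ B : ℝ}
    (hρ₁ : 1 < ρ₁) (h12 : ρ₁ < ρ₂)
    (hB : ∀ S : Finset (σ →₀ ℕ), ∑ α ∈ S,
      ‖MvPowerSeries.coeff α (eulerLog (P : MvPowerSeries σ ℂ))‖ * ρ₂ ^ α.degree ≤ B) :
    ∃ (Pn : NC σ) (C : ℝ), Pn.coeff 1 = 1 ∧ ab Pn = P ∧ 0 ≤ C ∧
      ∀ ε : ℝ, 0 < ε → ∃ Q E : NC σ, Q * Pn + E = 1 ∧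
        ∀ (H : Type) [NormedAddCommGroup H] [InnerProductSpace ℂ H] [CompleteSpace H]
          (X : σ → H →L[ℂ] H), (∀ j, ‖X j‖ ≤ 1) → ‖ncEval X Q‖ ≤ C ∧ ‖ncEval X E‖ ≤ ε := by
  have hρ0 : 0 < ρ₁ := zero_lt_one.trans hρ₁
  obtain ⟨N, hN0, hN1, hN2⟩ := exists_liftOrder P B hρ0 h12
  have hP1 : (pLift N P).coeff 1 = 1 := coeff_one_pLift hP hN0
  have hD : ∀ u ∈ (pLift N P).coeff.support, u.length ≤ N := fun u hu =>
    length_le_of_mem_support_pLift hu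
  have hinv : ∀ (H : Type) [NormedAddCommGroup H] [InnerProductSpace ℂ H] [CompleteSpace H]
      (Y : σ → H →L[ℂ] H), (∀ j, ‖Y j‖ ≤ ρ₁) →
        IsUnit (ncEval Y (pLift N P)) ∧ ‖Ring.inverse (ncEval Y (pLift N P))‖ ≤ 4 * Real.exp B :=
    fun H _ _ _ Y hY =>
      isUnit_ncEval_pLift ContinuousLinearMap.norm_id_le P hρ0 h12.le hB hN1 hN2 Y hY
  obtain ⟨C, hC0, hC⟩ := exists_QE_of_inv hP1 hD hρ₁ hinv
  exact ⟨pLift N P, C, hP1, ab_pLift hP hN0, hC0, hC⟩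

end StageC

/-! ### Proof of GKVVW Theorem 3.1 (polydisc case) -/

section Final

open MvPolynomial _root_.Matrix

variable [Fintype σ] [DecidableEq σ]

omit [Fintype σ] [DecidableEq σ] in
/-- Evaluation of the dilate `p(ρ z)`. [folklore] -/
theorem eval_bind₁_C_mul_X' (ρ : ℂ) (p : MvPolynomial σ ℂ) (z : σ → ℂ) :
    eval z (bind₁ (fun j => C ρ * X j) p) = eval (fun j => ρ * z j) p := by
  have := eval₂Hom_bind₁ (RingHom.id ℂ) z (fun j => C ρ * X j) p
  simp only [map_mul, eval₂Hom_C, eval₂Hom_X', RingHom.id_apply] at this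
  exact this

/-- **A contractive free determinantal representation of a dilate.** If `P(0) = 1` and `P` has
no zero on a closed polydisc of radius `r > 1`, then `P = det(1 - A Z)` with `‖A‖ ≤ 1` (nc lift,
free Positivstellensatz, lurking contraction, nilpotent realization). [folklore] -/
theorem exists_eq_det_of_noZero_radius (P : MvPolynomial σ ℂ) (hP : constantCoeff P = 1) {r : ℝ}
    (hr : 1 < r) (hPz : ∀ w : σ → ℂ, (∀ j, ‖w j‖ ≤ r) → eval w P ≠ 0) :
    ∃ (N : Type) (_ : Fintype N) (_ : DecidableEq N) (A : Matrix N N ℂ) (jj : N → σ),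
      ‖Matrix.toEuclideanCLM (𝕜 := ℂ) A‖ ≤ 1 ∧
        P = (1 - A.map (fun a : ℂ => (C a : MvPolynomial σ ℂ)) * Matrix.diagonal (X ∘ jj)).det := by
  have hr0 : 0 < r := zero_lt_one.trans hr
  -- radii `1 < ρ₁ < ρ₂ < r`
  set ρ₁ := (1 + r) / 2 with hρ₁
  set ρ₂ := (ρ₁ + r) / 2 with hρ₂
  have h1 : 1 < ρ₁ := by rw [hρ₁]; linarith
  have h12 : ρ₁ < ρ₂ := by rw [hρ₂]; linarith
  have h2r : ρ₂ < r := by rw [hρ₂]; linarith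
  have hρ₂0 : 0 < ρ₂ := by linarith
  -- the bound `G` for the partial sums of `Σ ‖(P⁻¹)_γ‖ ρ₂^{|γ|}` (from F1)
  have hcpt : IsCompact (Metric.closedBall (0 : σ → ℂ) r) := isCompact_closedBall _ _
  have hmem : ∀ w : σ → ℂ, w ∈ Metric.closedBall (0 : σ → ℂ) r ↔ ∀ j, ‖w j‖ ≤ r := by
    intro w
    rw [Metric.mem_closedBall, dist_zero_right, pi_norm_le_iff_of_nonneg hr0.le]
  have hcont : ContinuousOn (fun w : σ → ℂ => (eval w P)⁻¹) (Metric.closedBall 0 r) := by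
    refine continuousOn_of_forall_continuousAt fun w hw => ?_
    exact (MvPolynomial.continuous_eval P).continuousAt.inv₀ (hPz w ((hmem w).mp hw))
  obtain ⟨Kc, hKc⟩ := hcpt.exists_bound_of_continuousOn hcont
  have hKc' : ∀ w : σ → ℂ, (∀ j, ‖w j‖ ≤ r) → ‖(eval w P)⁻¹‖ ≤ Kc :=
    fun w hw => hKc w ((hmem w).mpr hw)
  have hKc0 : 0 ≤ Kc := le_trans (norm_nonneg _) (hKc' 0 fun j => by simp [hr0.le])
  have hx0 : 0 ≤ ρ₂ * r⁻¹ := by positivity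
  have hx1 : ρ₂ * r⁻¹ < 1 := by rw [mul_inv_lt_iff₀ hr0, one_mul]; exact h2r
  have hsum := summable_pow_degree (σ := σ) hx0 hx1
  set G := Kc * ∑' γ : σ →₀ ℕ, (ρ₂ * r⁻¹) ^ γ.degree with hG
  have hGb : ∀ T : Finset (σ →₀ ℕ),
      ∑ γ ∈ T, ‖MvPowerSeries.coeff γ ((P : MvPowerSeries σ ℂ)⁻¹)‖ * ρ₂ ^ γ.degree ≤ G := by
    intro T
    have hterm : ∀ γ ∈ T, ‖MvPowerSeries.coeff γ ((P : MvPowerSeries σ ℂ)⁻¹)‖ * ρ₂ ^ γ.degree ≤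
        Kc * (ρ₂ * r⁻¹) ^ γ.degree := by
      intro γ _
      have h := norm_coeff_inv_le P hr0 hPz hKc' γ
      calc ‖MvPowerSeries.coeff γ ((P : MvPowerSeries σ ℂ)⁻¹)‖ * ρ₂ ^ γ.degree
          ≤ Kc * r⁻¹ ^ γ.degree * ρ₂ ^ γ.degree := mul_le_mul_of_nonneg_right h (pow_nonneg hρ₂0.le _)
        _ = Kc * (ρ₂ * r⁻¹) ^ γ.degree := by rw [mul_pow]; ring
    refine (Finset.sum_le_sum hterm).trans ?_
    rw [← Finset.mul_sum, hG]
    exact mul_le_mul_of_nonneg_left (hsum.sum_le_tsum T fun γ _ => pow_nonneg hx0 _) hKc0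
  have hB := sum_norm_coeff_eulerLog_le P hρ₂0.le hGb
  -- the nc lift and its certificates
  obtain ⟨Pn, C₀, hP1, hab, hC0, huniv⟩ := exists_ncLift P hP h1 h12 hB
  -- the free Positivstellensatz
  have hc : (0 : ℝ) < 1 / (2 * C₀ + 2) := by positivity
  have hcC : 2 * C₀ * (1 / (2 * C₀ + 2)) < 1 := by
    rw [mul_one_div, div_lt_one (by positivity)]; linarith
  have hcert := hsqN_sub_smul_unitK_mem_coneN Pn hC0 huniv hc hcC
  -- the realization
  obtain ⟨N, _, _, A, jj, hA, hdet⟩ := ab_eq_det_of_certificate Pn hP1 hc hcert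
  exact ⟨N, inferInstance, inferInstance, A, jj, hA, by rw [← hab, hdet]; rfl⟩

end Final

end GKVVW

open MvPolynomial GKVVW in
/-- **Proof of `gkvvw_contractive_repr`** ([GrinshpanEtAl2015, Thm. 3.1], polydisc case). The
arXiv-v1 proof applies a realization-shift corollary (Cor. 2.2) at matrix level `1`, which fails
for nc rational functions; this proof instead lifts `p(ρ z)` to an nc polynomial `P̂` via the formal
Euler logarithm BEFORE the Positivstellensatz step (`exists_ncLift`), proves a free hereditary
Positivstellensatz for `|P̂|² - c²` by cone separation and a GNS construction with non-commuting left
shifts (`hsqN_sub_smul_unitK_mem_coneN`), extracts the lurking contraction and a nilpotent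
structured realization whose compression gives `P̂ = det(1 - A Z)` exactly at the level of words
(`ab_eq_det_of_certificate`), and finally undoes the dilation `z ↦ z/ρ` to make the contraction
strict. [cite: GrinshpanEtAl2015, Thm. 3.1 (p. 8)] -/
theorem gkvvw_contractive_repr_holds : gkvvw_contractive_repr := by
  intro σ _ p _ hp0 hp
  classical
  -- stability margin and the dilate `P = p(ρ z)`
  obtain ⟨r, hr, hpr⟩ := exists_radius_gt_one_of_noZero p hp
  set ρ : ℝ := (1 + r) / 2 with hρdef
  have hρ1 : 1 < ρ := by rw [hρdef]; linarith
  have hρr : ρ < r := by rw [hρdef]; linarith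
  have hρ0 : (0 : ℝ) < ρ := zero_lt_one.trans hρ1
  have hρC : (ρ : ℂ) ≠ 0 := Complex.ofReal_ne_zero.mpr hρ0.ne'
  set P : MvPolynomial σ ℂ := bind₁ (fun j => C (ρ : ℂ) * X j) p with hP
  have hPeval : ∀ z : σ → ℂ, eval z P = eval (fun j => (ρ : ℂ) * z j) p := fun z =>
    eval_bind₁_C_mul_X' _ _ _
  have hr' : 1 < r / ρ := by rw [lt_div_iff₀ hρ0, one_mul]; exact hρr
  have hPst : ∀ z : σ → ℂ, (∀ j, ‖z j‖ ≤ r / ρ) → eval z P ≠ 0 := by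
    intro z hz
    rw [hPeval]
    refine hpr _ fun j => ?_
    rw [norm_mul, Complex.norm_real, Real.norm_of_nonneg hρ0.le]
    calc ρ * ‖z j‖ ≤ ρ * (r / ρ) := mul_le_mul_of_nonneg_left (hz j) hρ0.le
      _ = r := mul_div_cancel₀ _ hρ0.ne'
  have hP0 : constantCoeff P = 1 := by
    rw [← MvPolynomial.eval_zero, show (0 : σ → ℂ) = fun _ => 0 from rfl]
    rw [show eval (fun _ => (0 : ℂ)) P = eval (0 : σ → ℂ) P from rfl, hPeval]
    simpa using hp0
  -- the contractive representation of the dilate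
  obtain ⟨N, _, _, A, jj, hAnorm, hdet⟩ := exists_eq_det_of_noZero_radius P hP0 hr' hPst
  -- undo the dilation with `φ : z ↦ z/ρ`
  set Zd : Matrix N N (MvPolynomial σ ℂ) := Matrix.diagonal (X ∘ jj) with hZd
  set φ : MvPolynomial σ ℂ →ₐ[ℂ] MvPolynomial σ ℂ := bind₁ fun j => C ((ρ : ℂ)⁻¹) * X j with hφ
  have hφP : φ P = p := by
    rw [hφ, hP, bind₁_bind₁]
    have : (fun i => bind₁ (fun j => C ((ρ : ℂ)⁻¹) * X j) (C (ρ : ℂ) * X i)) =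
        (X : σ → MvPolynomial σ ℂ) := by
      funext i
      rw [map_mul, bind₁_C_right, bind₁_X_right, ← mul_assoc, ← map_mul, mul_inv_cancel₀ hρC,
        map_one, one_mul]
    rw [this, bind₁_X_left]
    rfl
  have hφX : ∀ j, φ (X j) = C ((ρ : ℂ)⁻¹) * X j := fun j => bind₁_X_right _ _
  have hφC : ∀ a, φ (C a) = C a := fun a => bind₁_C_right _ _
  set K₀ : Matrix N N ℂ := ((ρ : ℂ)⁻¹) • A with hK₀
  have hφdet : φ ((1 - A.map (fun a : ℂ => (C a : MvPolynomial σ ℂ)) * Zd).det) =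
      (1 - K₀.map (fun a : ℂ => (C a : MvPolynomial σ ℂ)) * Zd).det := by
    rw [AlgHom.map_det]
    congr 1
    refine Matrix.ext fun n i => ?_
    rw [AlgHom.mapMatrix_apply, Matrix.map_apply, Matrix.sub_apply, Matrix.sub_apply, hZd,
      Matrix.mul_diagonal, Matrix.mul_diagonal, Matrix.map_apply, Matrix.map_apply, map_sub,
      map_mul, Function.comp_apply, hφX, hφC, Matrix.one_apply, hK₀, Matrix.smul_apply,
      smul_eq_mul, map_mul]
    split_ifs
    · rw [map_one]; ring
    · rw [map_zero]; ring
  -- Sylvester and sign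
  have hneg : (-K₀).map (fun a : ℂ => (C a : MvPolynomial σ ℂ)) =
      -(K₀.map fun a : ℂ => (C a : MvPolynomial σ ℂ)) := by
    refine Matrix.ext fun n i => ?_
    simp
  have hsyl := Matrix.det_one_sub_mul_comm Zd (K₀.map fun a : ℂ => (C a : MvPolynomial σ ℂ))
  have hfinal : p = (1 + Zd * (-K₀).map (fun a : ℂ => (C a : MvPolynomial σ ℂ))).det := by
    have := congrArg φ hdet
    rw [hφP, hφdet] at this
    rw [hneg, Matrix.mul_neg, ← sub_eq_add_neg, hsyl, this]
  -- reindex by `Fin R`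
  set e := Fintype.equivFin N with he
  refine ⟨Fintype.card N, Matrix.reindex e e (-K₀), fun i => jj (e.symm i), ?_, ?_⟩
  · refine lt_of_le_of_lt (norm_toEuclideanCLM_reindex_le e (-K₀)) ?_
    rw [map_neg, norm_neg, hK₀, map_smul, norm_smul, norm_inv, Complex.norm_real,
      Real.norm_of_nonneg hρ0.le]
    calc ρ⁻¹ * ‖Matrix.toEuclideanCLM (𝕜 := ℂ) A‖ ≤ ρ⁻¹ * 1 :=
        mul_le_mul_of_nonneg_left hAnorm (inv_nonneg.mpr hρ0.le)
      _ < 1 := by rw [mul_one]; exact inv_lt_one_of_one_lt₀ hρ1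
  · rw [hfinal, hZd]
    exact (det_pencil_reindex e (-K₀) jj).symm

end Literature.Analysis.OperatorTheory
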